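import Literature.Barriers.QuantumAdvantage.PPolyOraclesThm76QuantumKernel
import Literature.Barriers.QuantumAdvantage.PPolyOraclesThm76QuantumPost
import Literature.Computability.QuantumComplexity.CWrapKernelRel
import Literature.Computability.QuantumComplexity.BPPRelSubsetBQPRel
import Literature.Computability.QuantumComplexity.PromiseWrap
import Literature.Computability.QuantumComplexity.PadDecider
import Mathlib.Analysis.SpecificLimits.Normed
import HarnessLib

/-!
# Aaronson–Chen 2017, Lemma 7.5 (2)–(3): the quantum distinguisher (`aaronsonChen2017_lem75_quantum` discharged)

Discharge of the named fact `aaronsonChen2017_lem75_quantum` of `PPolyOraclesThm76.lean`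
(S. Aaronson, L. Chen, *Complexity-theoretic foundations of quantum supremacy experiments*,
CCC 2017, arXiv:1612.05903, Lemma 7.5 (2)–(3), proof in App. 13 p. 42: "apply the
Boneh–Lipton quantum period-finding algorithm … repeating polynomially many times"). The
uniform family `U` is the classical wrap (`exists_uniform_classicalWrap_rel`,
`CWrapKernelRel.lean`) of the quantum core `family (ofPoly q)` (Kitaev's eigenvalue estimation of
the shifts of a random offset at every candidate block length, `PeriodFindingFamily.lean`,
uniform by `family_isUniform`) by the polynomial-time post-processor `postFn q n₀`
(`PPolyOraclesThm76QuantumPost.lean`: continued-fraction candidates and the two-hit test), and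
the three clauses follow from the kernel bounds `kernelProb_found_le` / `kernelProb_found_ge`
(`PPolyOraclesThm76QuantumKernel.lean`) above an explicit threshold `n₀` (Shor's threshold and
`4608 · (q(n) + 1) ≤ ⌊√(2ⁿ)⌋`, `exists_threshold`), with the generic kernel facts of the tree
(`kernelProb_mono`, `kernelProb_add_kernelProb_le_one`, `kernelProb_add_kernelProb_compl`).

## References

* [AaronsonChen2017] arXiv:1612.05903, Lemma 7.5 (p. 30), App. 13 (p. 42).
* [BonehLipton1995] CRYPTO '95, LNCS 963, 424–437.   * [Kitaev1995] arXiv:quant-ph/9511026.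
* [Shor1997] SIAM J. Comput. 26 (1997), §5.   * [NielsenChuang2010] §2.2.5.
-/

noncomputable section

namespace Literature.Barriers.QuantumAdvantage

open _root_.Computability Literature.Computability.Complexity Literature.Computability.Cryptography
  Literature.Computability.Cryptography.PeriodFinding Literature.Computability.QuantumComplexity Finset Filter

/-! ### The threshold -/

/-- Polynomials are eventually below `2^{n/2}`. [folklore] -/
theorem exists_poly_le_two_pow_half (p : Polynomial ℕ) : ∃ n₀, ∀ n, n₀ ≤ n → p.eval n ≤ 2 ^ (n / 2) := by
  obtain ⟨c, k, hck⟩ := exists_eval_le_mul_pow_add p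
  -- `n^k = o(√2ⁿ)` and `√2ⁿ ≤ 2 · 2^{⌊n/2⌋}`
  have hr : (1 : ℝ) < Real.sqrt 2 := by
    rw [show (1 : ℝ) = Real.sqrt 1 by simp]; exact Real.sqrt_lt_sqrt (by norm_num) (by norm_num)
  have hlo := isLittleO_pow_const_const_pow_of_one_lt (R := ℝ) k hr
  have hlo0 := isLittleO_pow_const_const_pow_of_one_lt (R := ℝ) 0 hr
  have hc : (0 : ℝ) < 1 / (4 * ((c : ℝ) + 1)) := by positivity
  have h1 := hlo.def hc
  have h2 := hlo0.def hc
  rw [eventually_atTop] at h1 h2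
  obtain ⟨N₁, hN₁⟩ := h1
  obtain ⟨N₂, hN₂⟩ := h2
  refine ⟨max N₁ N₂, fun n hn => ?_⟩
  have e1 := hN₁ n (le_of_max_le_left hn)
  have e2 := hN₂ n (le_of_max_le_right hn)
  simp only [pow_zero, norm_one, Real.norm_eq_abs, abs_pow, Nat.abs_cast, abs_of_pos (lt_trans zero_lt_one hr)] at e1 e2
  -- `√2ⁿ ≤ 2 · 2^{n/2}`
  have hs : Real.sqrt 2 ^ n ≤ 2 * (2 : ℝ) ^ (n / 2) := by
    have hsq : Real.sqrt 2 ^ 2 = 2 := Real.sq_sqrt (by norm_num)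
    rcases Nat.even_or_odd n with ⟨m, hm⟩ | ⟨m, hm⟩
    · rw [hm, show m + m = 2 * m by ring, pow_mul, hsq, Nat.mul_div_cancel_left _ (by norm_num)]
      have : (0 : ℝ) < 2 ^ m := by positivity
      linarith
    · rw [hm, pow_succ, pow_mul, hsq, show (2 * m + 1) / 2 = m by omega]
      have h2le : Real.sqrt 2 ≤ 2 := by
        rw [show (2 : ℝ) = Real.sqrt 4 by rw [show (4:ℝ) = 2 ^ 2 by norm_num, Real.sqrt_sq (by norm_num)]]
        exact Real.sqrt_le_sqrt (by norm_num)
      have : (0 : ℝ) < 2 ^ m := by positivity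
      nlinarith
  have hreal : ((p.eval n : ℕ) : ℝ) ≤ (2 : ℝ) ^ (n / 2) := by
    calc ((p.eval n : ℕ) : ℝ) ≤ c * (n : ℝ) ^ k + c := by exact_mod_cast hck n
      _ ≤ (c + 1) * (1 / (4 * (c + 1)) * Real.sqrt 2 ^ n) + (c + 1) * (1 / (4 * (c + 1)) * Real.sqrt 2 ^ n) := by
          have hc1 : (c : ℝ) ≤ c + 1 := by linarith
          have hpos : 0 ≤ (n : ℝ) ^ k := by positivity
          nlinarith
      _ = Real.sqrt 2 ^ n / 2 := by field_simp; ring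
      _ ≤ (2 : ℝ) ^ (n / 2) := by linarith
  exact_mod_cast hreal

/-- **The threshold**: above `n₀`, `⌊√(2ⁿ)⌋` dominates Shor's threshold, `23`, and `4608 · nL`.
[cite: AaronsonChen2017, App. 13 (sufficiently large n)] -/
theorem exists_threshold (q : Polynomial ℕ) : ∃ n₀, ∀ n, n₀ ≤ n →
    shorThreshold ≤ Nat.sqrt (2 ^ n) ∧ 23 ≤ Nat.sqrt (2 ^ n) ∧ 4608 * nL (ofPoly q) n ≤ Nat.sqrt (2 ^ n) := by
  obtain ⟨n₀, hn₀⟩ := exists_poly_le_two_pow_half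
    (Polynomial.C 4608 * (q + Polynomial.C 1) + Polynomial.C (shorThreshold + 23))
  refine ⟨n₀, fun n hn => ?_⟩
  have h := hn₀ n hn
  simp only [Polynomial.eval_add, Polynomial.eval_mul, Polynomial.eval_C] at h
  have hsq : 2 ^ (n / 2) ≤ Nat.sqrt (2 ^ n) := by
    rw [Nat.le_sqrt, ← pow_add]
    exact Nat.pow_le_pow_right (by norm_num) (by omega)
  have hnL : nL (ofPoly q) n = q.eval n + 1 := rfl
  refine ⟨?_, ?_, ?_⟩ <;> omega

/-! ### The discharge -/

/-- Outputs with prefix `[true]` and outputs with prefix `[false]` are disjoint. [folklore] -/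
theorem not_prefix_true_of_prefix_false {z : List Bool} (h : [false] <+: z) : ¬ [true] <+: z := by
  intro h'
  cases z with
  | nil => simp at h
  | cons b z =>
    rw [List.cons_prefix_cons] at h h'
    exact Bool.false_ne_true (h.1.trans h'.1.symm)

/-- **Aaronson–Chen 2017, Lemma 7.5 (2)–(3), quantum half — the named fact
`aaronsonChen2017_lem75_quantum` holds.** For a `PRP` `F` with block length `ℓ n ≥ n` there
is ONE polynomial-time uniform Clifford+T family with oracle gates which, relative to the oracle
`acLang W` of any table assignment `W`, accepts (i) with probability `≥ 2/3` on the short inputs,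
(ii) with probability `≥ 2/3` whenever the input's level is a permutation, and (iii) with
probability `≤ 1/3` whenever the input's level is `PRF^mod_{k,a}` (Boneh–Lipton / Shor period
finding on every candidate block length, `O(1)` repetitions and a two-hit test; classical
post-processing wrapped by `exists_uniform_classicalWrap_rel`).
[cite: AaronsonChen2017, Lemma 7.5 (2)–(3), App. 13 (p. 42)] [cite: BonehLipton1995, Thm. 1] -/
theorem aaronsonChen2017_lem75_quantum_holds : aaronsonChen2017_lem75_quantum := by
  intro F κ ℓ hF hℓ
  obtain ⟨q, hq⟩ := hF.isEfficientFamily.2.1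
  obtain ⟨n₀, hn₀⟩ := exists_threshold q
  obtain ⟨U, hUu, hU⟩ := exists_uniform_classicalWrap_rel (h := fun w : List Bool => w) (g := postFn q n₀)
    (F := family (ofPoly q)) (PolyTimeComputable.id _) (postFn_mem_FP q n₀) (family_isUniform q)
  -- the wrap dominates the core's kernel on the outputs the post-processor accepts / rejects
  have hacc : ∀ (A : Language Bool) (x : List Bool),
      (family (ofPoly q)).kernelProb A x {y | postFn q n₀ (boolPair x y) = [true]} ≤ U.acceptProbOn A x := by
    intro A x
    rw [← kernelProb_prefix_true_eq_acceptProbOn]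
    refine (hU A x _).trans (Literature.Computability.QuantumComplexity.kernelProb_mono U A x fun z hz => ?_)
    obtain ⟨y, hy, hpre⟩ := hz
    rw [Set.mem_setOf_eq] at hy
    rw [Set.mem_setOf_eq, ← hy]
    exact hpre
  have hrej : ∀ (A : Language Bool) (x : List Bool),
      U.acceptProbOn A x ≤ 1 - (family (ofPoly q)).kernelProb A x {y | postFn q n₀ (boolPair x y) = [false]} := by
    intro A x
    rw [← kernelProb_prefix_true_eq_acceptProbOn]
    have h1 := hU A x {y | postFn q n₀ (boolPair x y) = [false]}
    have h2 := Literature.Computability.QuantumComplexity.kernelProb_add_kernelProb_le_one U A x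
      (E₁ := {z | ∃ y ∈ {y | postFn q n₀ (boolPair x y) = [false]}, postFn q n₀ (boolPair x y) <+: z})
      (E₂ := {z | [true] <+: z}) (Set.disjoint_left.2 fun z hz ht => by
        obtain ⟨y, hy, hpre⟩ := hz
        rw [Set.mem_setOf_eq] at hy ht
        rw [hy] at hpre
        exact not_prefix_true_of_prefix_false hpre ht)
    linarith
  refine ⟨n₀, U, hUu, fun A x hx => ?_, fun W x hx hW => ?_, fun W x hx k a hk ha hWk => ?_⟩
  · -- (i) short inputs: the post-processor always accepts
    refine le_trans ?_ (hacc A x)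
    have huniv : {y | postFn q n₀ (boolPair x y) = [true]} = Set.univ := by
      ext y
      simp only [Set.mem_setOf_eq, Set.mem_univ, postFn_apply, hx, decide_true, Bool.true_or]
    have h1 : (family (ofPoly q)).kernelProb A x Set.univ = 1 := by
      unfold QCircuitFamily.kernelProb
      rw [(((family (ofPoly q)).kernel A x).toOuterMeasure_apply_eq_one_iff _).2 (Set.subset_univ _)]
      rfl
    rw [huniv, h1]
    norm_num
  · -- (ii) a permutation level: found with probability ≤ 1/4
    refine le_trans ?_ (hacc (acLang W) x)
    have hsub : {y | Found (ofPoly q) x.length (readOf (ofPoly q) x.length y)}ᶜ ⊆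
        {y | postFn q n₀ (boolPair x y) = [true]} := by
      intro y hy
      rw [Set.mem_compl_iff, Set.mem_setOf_eq] at hy
      rw [Set.mem_setOf_eq, postFn_apply]
      simp [hy]
    have hle := kernelProb_found_le (ofPoly q) W x hW (hn₀ x.length hx).2.2
    have hcompl := Literature.Computability.QuantumComplexity.PadDecider.kernelProb_add_kernelProb_compl (family (ofPoly q))
      (acLang W) x {y | Found (ofPoly q) x.length (readOf (ofPoly q) x.length y)}
    have hmono := Literature.Computability.QuantumComplexity.kernelProb_mono (family (ofPoly q)) (acLang W) x hsub
    linarith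
  · -- (iii) a `PRF^mod` level: found with probability ≥ 2/3
    refine (hrej (acLang W) x).trans ?_
    have hsub : {y | Found (ofPoly q) x.length (readOf (ofPoly q) x.length y)} ⊆
        {y | postFn q n₀ (boolPair x y) = [false]} := by
      intro y hy
      rw [Set.mem_setOf_eq] at hy
      rw [Set.mem_setOf_eq, postFn_apply]
      simp [hy, not_lt.2 hx]
    obtain ⟨hthr, h23, -⟩ := hn₀ x.length hx
    have hLmax : ℓ x.length ≤ x.length + (ofPoly q).Lmax x.length := by
      have := (hq x.length).2.1
      show ℓ x.length ≤ x.length + q.eval x.length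
      omega
    have hge := kernelProb_found_ge (ofPoly q) hF W x (hℓ x.length) hLmax hk ha hWk hthr h23
    have hmono := Literature.Computability.QuantumComplexity.kernelProb_mono (family (ofPoly q)) (acLang W) x hsub
    linarith

end Literature.Barriers.QuantumAdvantage

end
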